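import Summits.CriticalPhenomena.PercolationContinuityZ3.Theorems.PercNearOneGluingNoHeavyLowerTailSunflowerTBernT2Lev
import Summits.CriticalPhenomena.PercolationContinuityZ3.Theorems.PercNearOneGluingNoHeavyLowerTailSunflowerTBernT2Pack
import Summits.CriticalPhenomena.PercolationContinuityZ3.Theorems.PercNearOneGluingNoHeavyLowerTailSunflowerTBernMerge
import HarnessLib

/-!
# `NoHeavyLowerTail` (crux stmt-CriticalPhenomena-4575), abstract sunflower cubic: T-BERN — the certificate for every
# IRREDUCIBLE family (the endgame dispatch of the reduction)

Support file (seat `prim-ineq-prove-1` gen 65; `--supports stmt-CriticalPhenomena-4575`).  No `sorry`, no named facts.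
Memo: run/shared/lean/prim/prim-ineq-prove-1/FINDING-REDUCTION-prove1-g65.md §1.

A nonempty admissible family (`AdmissibleOn s b β V t u vv m`, `0 < b ≤ β ≤ 1`, `0 ≤ s ≤ 1`) is IRREDUCIBLE when it has
at most one slack petal (`m < u`), at most one tight rich petal (`m = u`, `m > b`, `vv > β`: "T2"), at most one h-petal
(`u = m = b`, `vv > β`), and no pair {h-petal, leveraged T2 (`β m ≤ b vv`)} — these are exactly the families on which none of the
moves R1–R4 of the reduction acts.  **`domOn_irreducible`**: every irreducible family admits the `TBern` certificate `DomOn`.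
Proof = dispatch: if every petal is γ-heavy, `domOn_of_gammaHeavy`; otherwise the unique non-γ-heavy petal `P` is the unique slack
petal (tight petals are γ-heavy, `gammaHeavy_of_tight`), every other petal is a pack petal (`vv = β`; floors included), the h-petal or the T2 petal, and
the family is one of: {P, pack} (`domOn_of_noLeverage`), {P, pack, h} / {P, pack, leveraged T2} (`domOn_hub_pack_lev`),
{P, pack, non-leveraged T2} (`domOn_of_noLeverage`), {P, pack, non-leveraged T2, h} (`domOn_hub_packT_h`).
-/

noncomputable section

namespace Summit.CriticalPhenomena.PercolationContinuityZ3.Theorems.SunflowerPartition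

namespace SafeCalc

namespace LinkedCurrency

open Finset Polynomial

variable {ι : Type*}

/-- A finset with pairwise-equal elements is empty or a singleton (helper). [this work] -/
theorem eq_empty_or_singleton_of_forall_eq {s : Finset ι} (h : ∀ a ∈ s, ∀ b ∈ s, a = b) :
    s = ∅ ∨ ∃ a, s = {a} := by
  rcases s.eq_empty_or_nonempty with hs | ⟨a, ha⟩
  · exact Or.inl hs
  · exact Or.inr ⟨a, eq_singleton_iff_unique_mem.2 ⟨ha, fun b hb => h b hb a ha⟩⟩

/-- **The `TBern` certificate for irreducible families.**  See the module docstring. [this work] -/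
theorem domOn_irreducible [DecidableEq ι] {s b β V : ℝ} (hb : 0 < b) (hbβ : b ≤ β) (hβ1 : β ≤ 1) (hs0 : 0 ≤ s)
    (hs1 : s ≤ 1) {t : Finset ι} (ht : t.Nonempty) {u vv m : ι → ℝ} (hadm : AdmissibleOn s b β V t u vv m)
    (hslack1 : ∀ i ∈ t, ∀ j ∈ t, m i < u i → m j < u j → i = j)
    (hT1 : ∀ i ∈ t, ∀ j ∈ t, (m i = u i ∧ b < m i ∧ β < vv i) → (m j = u j ∧ b < m j ∧ β < vv j) → i = j)
    (hH1 : ∀ i ∈ t, ∀ j ∈ t, (u i = b ∧ m i = b ∧ β < vv i) → (u j = b ∧ m j = b ∧ β < vv j) → i = j)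
    (hnolev : ∀ i ∈ t, ∀ j ∈ t, (u i = b ∧ m i = b ∧ β < vv i) → (m j = u j ∧ b < m j ∧ β < vv j) →
      b * vv j < β * m j) :
    DomOn s b β V t u vv m := by
  have hs' : 0 ≤ 1 - s := sub_nonneg.2 hs1
  have hβ : 0 < β := hb.trans_le hbβ
  obtain ⟨hub, hu1, hvβ, hv1, hmb, hmu, hmv, hpu, hpv, hpg⟩ := id hadm
  by_cases hall : ∀ l ∈ t, ((1 - s) * b + s * β) * (s + (1 - s) * u l) ≤ (s + (1 - s) * b) * ((1 - s) * m l + s * vv l)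
  · exact domOn_of_gammaHeavy hb hbβ hs0 hs1 ht hadm hall
  push Not at hall
  obtain ⟨P, hP, hPlt⟩ := hall
  -- `P` is slack, hence the unique slack petal; everybody else is tight
  have hPslack : m P < u P := by
    by_contra hnot
    have hmeq : m P = u P := le_antisymm (hmu P hP) (not_lt.1 hnot)
    exact absurd (gammaHeavy_of_tight hs0 hs1 hb.le hβ1 (hub P hP) (hvβ P hP) hmeq) (not_le.2 hPlt)
  have htight : ∀ l ∈ t, l ≠ P → m l = u l := by
    intro l hl hlP
    by_contra hne
    exact hlP (hslack1 l hl P hP (lt_of_le_of_ne (hmu l hl) hne) hPslack)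
  -- `P` is non-leveraged: b g_P ≤ a₀ u_P
  have hPlev : b * ((1 - s) * m P + s * vv P) ≤ ((1 - s) * b + s * β) * u P := by
    have hA₀ : 0 < s + (1 - s) * b := by nlinarith [hub P hP, hu1 P hP]
    -- A₀ g_P < a₀ A_P and b A_P ≤ A₀ u_P
    have h1 : b * (s + (1 - s) * u P) ≤ (s + (1 - s) * b) * u P := by nlinarith [hub P hP]
    have h2 : (s + (1 - s) * b) * (b * ((1 - s) * m P + s * vv P)) ≤ (s + (1 - s) * b) * (((1 - s) * b + s * β) * u P) := by
      calc (s + (1 - s) * b) * (b * ((1 - s) * m P + s * vv P)) = b * ((s + (1 - s) * b) * ((1 - s) * m P + s * vv P)) := by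
            ring
        _ ≤ b * (((1 - s) * b + s * β) * (s + (1 - s) * u P)) := mul_le_mul_of_nonneg_left hPlt.le hb.le
        _ = ((1 - s) * b + s * β) * (b * (s + (1 - s) * u P)) := by ring
        _ ≤ ((1 - s) * b + s * β) * ((s + (1 - s) * b) * u P) :=
            mul_le_mul_of_nonneg_left h1 (by nlinarith)
        _ = (s + (1 - s) * b) * (((1 - s) * b + s * β) * u P) := by ring
    exact le_of_mul_le_mul_left h2 hA₀
  -- the three classes among the other petals
  set Q := (t.erase P).filter (fun l => vv l = β) with hQd
  set Hs := (t.erase P).filter (fun l => m l = b ∧ β < vv l) with hHsd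
  set Ts := (t.erase P).filter (fun l => b < m l ∧ β < vv l) with hTsd
  have hPt : P ∉ t.erase P := notMem_erase P t
  have hPQ : P ∉ Q := fun h => hPt (mem_of_mem_filter P h)
  have hQpack : ∀ j ∈ Q, vv j = β ∧ m j = u j := fun j hj => by
    have hj' := mem_filter.1 hj
    exact ⟨hj'.2, htight j (mem_of_mem_erase hj'.1) (mem_erase.1 hj'.1).1⟩
  have hQlev : ∀ j ∈ Q, b * ((1 - s) * m j + s * vv j) ≤ ((1 - s) * b + s * β) * u j := fun j hj => by
    obtain ⟨hvj, hmj⟩ := hQpack j hj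
    rw [hvj, hmj]
    have := hub j (mem_of_mem_erase (mem_filter.1 hj).1)
    nlinarith [mul_nonneg hs0 hβ.le]
  have hdecomp : t.erase P = Q ∪ (Hs ∪ Ts) := by
    ext l
    simp only [mem_union, hQd, hHsd, hTsd, mem_filter]
    constructor
    · intro hl
      have hl' : l ∈ t := mem_of_mem_erase hl
      have hlP : l ≠ P := (mem_erase.1 hl).1
      rcases eq_or_lt_of_le (hvβ l hl') with hv | hv
      · exact Or.inl ⟨hl, hv.symm⟩
      · rcases eq_or_lt_of_le (hmb l hl') with hm' | hm'
        · exact Or.inr (Or.inl ⟨hl, hm'.symm, hv⟩)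
        · exact Or.inr (Or.inr ⟨hl, hm', hv⟩)
    · rintro (h | h | h)
      · exact h.1
      · exact h.1
      · exact h.1
  -- at most one h-petal and one T2 petal
  have hHs1 : Hs = ∅ ∨ ∃ a, Hs = {a} := by
    refine eq_empty_or_singleton_of_forall_eq fun i hi j hj => ?_
    have hi' := mem_filter.1 hi; have hj' := mem_filter.1 hj
    have hit := mem_of_mem_erase hi'.1; have hjt := mem_of_mem_erase hj'.1
    have hui : u i = b := by rw [← htight i hit (mem_erase.1 hi'.1).1]; exact hi'.2.1
    have huj : u j = b := by rw [← htight j hjt (mem_erase.1 hj'.1).1]; exact hj'.2.1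
    exact hH1 i hit j hjt ⟨hui, hi'.2.1, hi'.2.2⟩ ⟨huj, hj'.2.1, hj'.2.2⟩
  have hTs1 : Ts = ∅ ∨ ∃ a, Ts = {a} := by
    refine eq_empty_or_singleton_of_forall_eq fun i hi j hj => ?_
    have hi' := mem_filter.1 hi; have hj' := mem_filter.1 hj
    have hit := mem_of_mem_erase hi'.1; have hjt := mem_of_mem_erase hj'.1
    exact hT1 i hit j hjt ⟨htight i hit (mem_erase.1 hi'.1).1, hi'.2.1, hi'.2.2⟩
      ⟨htight j hjt (mem_erase.1 hj'.1).1, hj'.2.1, hj'.2.2⟩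
  -- membership facts for elements of Hs / Ts
  have hHs_mem : ∀ h ∈ Hs, h ∈ t ∧ h ≠ P ∧ h ∉ Q ∧ u h = b ∧ m h = b ∧ β < vv h := fun h hh => by
    have hh' := mem_filter.1 hh
    have hht := mem_of_mem_erase hh'.1
    have hhP := (mem_erase.1 hh'.1).1
    refine ⟨hht, hhP, fun hq => ?_, by rw [← htight h hht hhP]; exact hh'.2.1, hh'.2.1, hh'.2.2⟩
    have := (mem_filter.1 hq).2
    linarith [hh'.2.2]
  have hTs_mem : ∀ r ∈ Ts, r ∈ t ∧ r ≠ P ∧ r ∉ Q ∧ m r = u r ∧ b < m r ∧ β < vv r := fun r hr => by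
    have hr' := mem_filter.1 hr
    have hrt := mem_of_mem_erase hr'.1
    have hrP := (mem_erase.1 hr'.1).1
    refine ⟨hrt, hrP, fun hq => ?_, htight r hrt hrP, hr'.2.1, hr'.2.2⟩
    have := (mem_filter.1 hq).2
    linarith [hr'.2.2]
  have ht_eq : t = insert P (Q ∪ (Hs ∪ Ts)) := by rw [← hdecomp, insert_erase hP]
  -- DISPATCH
  rcases hHs1 with hHs0 | ⟨h, hHse⟩ <;> rcases hTs1 with hTs0 | ⟨r, hTse⟩
  · -- {P, pack}: no leverage
    refine domOn_of_noLeverage hb hbβ hs0 hs1 ht hadm fun l hl => ?_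
    rw [ht_eq, hHs0, hTs0, empty_union, union_empty, mem_insert] at hl
    rcases hl with rfl | hl
    · exact hPlev
    · exact hQlev l hl
  · -- {P, pack, T2}
    obtain ⟨hrt, hrP, hrQ, hmr, _, hvr⟩ := hTs_mem r (by rw [hTse]; exact mem_singleton_self r)
    by_cases hlev : β * m r ≤ b * vv r
    · have ht2 : t = insert r (insert P Q) := by
        rw [ht_eq, hHs0, hTse, empty_union, union_comm, ← insert_eq, Finset.insert_comm]
      rw [ht2] at hadm ⊢
      exact domOn_hub_pack_lev hb hbβ hβ1 hs0 hs1 hPQ hrQ hrP hadm hQpack hmr hlev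
    · push Not at hlev
      refine domOn_of_noLeverage hb hbβ hs0 hs1 ht hadm fun l hl => ?_
      rw [ht_eq, hHs0, hTse, empty_union, mem_insert, mem_union, mem_singleton] at hl
      rcases hl with rfl | hl | rfl
      · exact hPlev
      · exact hQlev l hl
      · rw [← hmr]
        nlinarith [mul_le_mul_of_nonneg_left hlev.le hs0]
  · -- {P, pack, h}
    obtain ⟨hht, hhP, hhQ, huh, hmh, hvh⟩ := hHs_mem h (by rw [hHse]; exact mem_singleton_self h)
    have ht2 : t = insert h (insert P Q) := by
      rw [ht_eq, hHse, hTs0, union_empty, union_comm, ← insert_eq, Finset.insert_comm]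
    rw [ht2] at hadm ⊢
    refine domOn_hub_pack_lev hb hbβ hβ1 hs0 hs1 hPQ hhQ hhP hadm hQpack (by rw [hmh, huh]) ?_
    rw [hmh]; nlinarith
  · -- {P, pack, T2, h}: the T2 petal is non-leveraged by `hnolev`
    obtain ⟨hht, hhP, hhQ, huh, hmh, hvh⟩ := hHs_mem h (by rw [hHse]; exact mem_singleton_self h)
    obtain ⟨hrt, hrP, hrQ, hmr, hbr, hvr⟩ := hTs_mem r (by rw [hTse]; exact mem_singleton_self r)
    have hhr : h ≠ r := fun e => by rw [e] at hmh; rw [hmh] at hbr; exact lt_irrefl _ hbr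
    have hrz : b * vv r ≤ β * m r := (hnolev h hht r hrt ⟨huh, hmh, hvh⟩ ⟨hmr, hbr, hvr⟩).le
    have ht2 : t = insert h (insert r (insert P Q)) := by
      rw [ht_eq, hHse, hTse]
      ext l
      simp only [mem_insert, mem_union, mem_singleton]
      tauto
    rw [ht2] at hadm ⊢
    exact domOn_hub_packT_h hb hbβ hβ1 hs0 hs1 hPQ hrQ hrP hhQ hhP hhr hadm hQpack hmr hrz huh hmh

end LinkedCurrency

end SafeCalc

end Summit.CriticalPhenomena.PercolationContinuityZ3.Theorems.SunflowerPartition
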